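import Literature.MathematicalPhysics.QuantumManyBody.CLYCoulombDecomposition
import Literature.MathematicalPhysics.QuantumManyBody.JelliumOnsagerBound
import HarnessLib

/-!
# The sliding lemma at scale `ℓ` and for the uniform background of a box

Topic `Literature/MathematicalPhysics/QuantumManyBody` (electrostatics groundwork for the charged
Bose gas, `JelliumBoseGas.foldyLaw`). [LiebSolovej2001, Lemma 3.1] is used at the scale `ℓ` of
the small boxes: with `χ_ℓ(x) = χ(x/ℓ)` and the Yukawa potential `Y_{ω(t)/ℓ}` the error is
`ω(t)N/(2ℓ)` ("by rescaling from boxes of size 1 to boxes of size `ℓ`"). This file performs that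
rescaling on the Conlon–Lieb–Yau decomposition of `CLYCoulombDecomposition.lean` and records the
resulting sliding lemmas, including the case of the uniform background `ρ 𝟙_Λ` of a box
`Λ = (0, L)³` that enters `JelliumBoseGas.jelliumInteraction`:

* `Coulomb.cly_coulomb_decomposition_scaled` — for `ω ≥ ω₀(χ)` and every `ℓ > 0`:
  `|z|⁻¹ = ∫ Φ(p)cos(2π⟨p,z⟩)dp + h(z/ℓ) e^{-ω|z|/ℓ}/|z|` with `Φ ≥ 0`, `∫Φ = ω/ℓ`, and
  `h(z/ℓ) = (∫χ_ℓ²)⁻¹ ∫ χ_ℓ(u)χ_ℓ(u - z) du`;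
* `Coulomb.sliding_lemma_jellium_scaled` — [LiebSolovej2001, Lemma 3.1] at scale `ℓ` for a
  general background `g ∈ L¹`: `(∫χ_ℓ²)⁻¹ ∫ U_z dz - ω N/(2ℓ) ≤ U`, `U_z` built with
  `w_z(x, y) = χ_ℓ(x - z) Y_{ω/ℓ}(x - y) χ_ℓ(y - z)`;
* `Coulomb.sliding_lemma_jellium_box` — the same for the uniform background of density `ρ` in
  the box `Λ_L` (all integrability side conditions discharged):
  `(∫χ_ℓ²)⁻¹ ∫ [∑_{i<j} w_z(xᵢ,xⱼ) - ρ∑ᵢ∫_Λ w_z(xᵢ,y)dy + ½ρ²∬_{Λ×Λ} w_z] dz - ωN/(2ℓ)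
   ≤ ∑_{i<j}|xᵢ-xⱼ|⁻¹ - ρ∑ᵢ∫_Λ|xᵢ-y|⁻¹dy + ½ρ²∬_{Λ×Λ}|x-y|⁻¹`.

## References

* [LiebSolovej2001] E. H. Lieb, J. P. Solovej, Commun. Math. Phys. 217 (2001) 127–163, Lemma 3.1
  and its proof, last sentence (arXiv:cond-mat/0007425, p. 8).
* [ConlonLiebYau1988] J. G. Conlon, E. H. Lieb, H.-T. Yau, Commun. Math. Phys. 116 (1988)
  417–448, Lemma 2.1.
-/

noncomputable section

open MeasureTheory Set Filter Real
open scoped ENNReal NNReal Topology InnerProductSpace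

namespace Literature.MathematicalPhysics.QuantumManyBody.Coulomb

open BoseGas Literature.Analysis.UnboundedOperators JelliumBoseGas

variable {χ : Space → ℝ}

/-! ### Scaling identities -/

/-- `∫ χ(u/ℓ)² du = ℓ³ ∫ χ²`. [folklore] -/
theorem integral_sq_comp_inv_smul (χ : Space → ℝ) {ℓ : ℝ} (hℓ : 0 < ℓ) :
    ∫ u, χ (ℓ⁻¹ • u) ^ 2 = ℓ ^ 3 * ∫ u, χ u ^ 2 := by
  have h := Measure.integral_comp_inv_smul_of_nonneg volume (fun u : Space => χ u ^ 2) hℓ.le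
  rw [finrank_euclideanSpace_fin, smul_eq_mul] at h
  exact h

/-- `∫ χ(u/ℓ)χ((u - z)/ℓ) du = ℓ³ ∫ χ(u)χ(u - z/ℓ) du`. [folklore] -/
theorem integral_comp_inv_smul_mul (χ : Space → ℝ) {ℓ : ℝ} (hℓ : 0 < ℓ) (z : Space) :
    ∫ u, χ (ℓ⁻¹ • u) * χ (ℓ⁻¹ • (u - z)) = ℓ ^ 3 * ∫ u, χ u * χ (u - ℓ⁻¹ • z) := by
  have h := Measure.integral_comp_inv_smul_of_nonneg volume
    (fun u : Space => χ u * χ (u - ℓ⁻¹ • z)) hℓ.le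
  rw [finrank_euclideanSpace_fin, smul_eq_mul] at h
  rw [← h]
  refine integral_congr_ae (Eventually.of_forall fun u => ?_)
  simp only [smul_sub]

/-- **The smearing function is scale invariant**: `h_ℓ(z) = h(z/ℓ)`, i.e.
`(∫χ_ℓ²)⁻¹ ∫ χ_ℓ(u)χ_ℓ(u - z) du = (∫χ²)⁻¹ ∫ χ(u)χ(u - z/ℓ) du`. [folklore] -/
theorem smearing_comp_inv_smul (χ : Space → ℝ) {ℓ : ℝ} (hℓ : 0 < ℓ) (z : Space) :
    (∫ u, χ (ℓ⁻¹ • u) ^ 2)⁻¹ * ∫ u, χ (ℓ⁻¹ • u) * χ (ℓ⁻¹ • (u - z)) =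
      (∫ u, χ u ^ 2)⁻¹ * ∫ u, χ u * χ (u - ℓ⁻¹ • z) := by
  rw [integral_sq_comp_inv_smul χ hℓ, integral_comp_inv_smul_mul χ hℓ z]
  have h3 : ℓ ^ 3 ≠ 0 := by positivity
  calc (ℓ ^ 3 * ∫ u, χ u ^ 2)⁻¹ * (ℓ ^ 3 * ∫ u, χ u * χ (u - ℓ⁻¹ • z))
      = (ℓ ^ 3)⁻¹ * ℓ ^ 3 * ((∫ u, χ u ^ 2)⁻¹ * ∫ u, χ u * χ (u - ℓ⁻¹ • z)) := by ring
    _ = (∫ u, χ u ^ 2)⁻¹ * ∫ u, χ u * χ (u - ℓ⁻¹ • z) := by rw [inv_mul_cancel₀ h3, one_mul]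

/-- The Yukawa potential `e^{-ν|x|}/|x|` is integrable on `ℝ³` (`ν > 0`). [folklore] -/
theorem integrable_yukawa_exp {ν : ℝ} (hν : 0 < ν) :
    Integrable fun x : Space => Real.exp (-(ν * ‖x‖)) / ‖x‖ := by
  have h := integrable_yukawa (m := ν ^ 2) (by positivity)
  rw [Real.sqrt_sq hν.le] at h
  exact h

/-! ### The CLY decomposition at scale `ℓ` -/

/-- **The Conlon–Lieb–Yau decomposition at scale `ℓ`** [ConlonLiebYau1988, Lemma 2.1;
LiebSolovej2001, proof of Lemma 3.1 ("rescaling from boxes of size 1 to boxes of size `ℓ`")]: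
with `χ`, `ω₀(χ)` as in `cly_coulomb_decomposition`, for every `ω ≥ ω₀` and `ℓ > 0` there is
`Φ ≥ 0` measurable and integrable with `∫ Φ = ω/ℓ` and, for all `z ≠ 0`,
`|z|⁻¹ = ∫ Φ(p)cos(2π⟨p,z⟩)dp + (∫χ_ℓ²)⁻¹(∫χ_ℓ(u)χ_ℓ(u-z)du) · e^{-ω|z|/ℓ}/|z|`, `χ_ℓ = χ(·/ℓ)`
(from the scale-one statement at `z/ℓ`, with `Φ_ℓ(p) = ℓ²Φ(ℓp)`).
[cite: LiebSolovej2001, Lemma 3.1 (proof)] -/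
theorem cly_coulomb_decomposition_scaled (hχ : ContDiff ℝ (⊤ : ℕ∞) χ) (hsupp : HasCompactSupport χ)
    (hχ0 : (∫ u, χ u ^ 2) ≠ 0) :
    ∃ ω₀ : ℝ, 0 < ω₀ ∧ ∀ ω : ℝ, ω₀ ≤ ω → ∀ ℓ : ℝ, 0 < ℓ → ∃ Φ : Space → ℝ, Measurable Φ ∧
      Integrable Φ ∧ (∀ p, 0 ≤ Φ p) ∧ (∫ p, Φ p) = ω / ℓ ∧ ∀ z : Space, z ≠ 0 → ‖z‖⁻¹ =
        (∫ p, Φ p * Real.cos (2 * π * ⟪p, z⟫_ℝ)) +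
          ((∫ u, χ (ℓ⁻¹ • u) ^ 2)⁻¹ * ∫ u, χ (ℓ⁻¹ • u) * χ (ℓ⁻¹ • (u - z))) *
            (Real.exp (-(ω / ℓ * ‖z‖)) / ‖z‖) := by
  obtain ⟨ω₀, hω₀, H⟩ := cly_coulomb_decomposition hχ hsupp hχ0
  refine ⟨ω₀, hω₀, fun ω hω ℓ hℓ => ?_⟩
  obtain ⟨Φ, hΦm, hΦi, hΦ0, hΦint, hF⟩ := H ω hω
  have hℓ0 : ℓ ≠ 0 := hℓ.ne'
  refine ⟨fun p => ℓ ^ 2 * Φ (ℓ • p), (hΦm.comp (measurable_const_smul ℓ)).const_mul _,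
    (hΦi.comp_smul hℓ0).const_mul _, fun p => mul_nonneg (sq_nonneg ℓ) (hΦ0 _), ?_,
    fun z hz => ?_⟩
  · rw [integral_const_mul]
    have h := Measure.integral_comp_smul_of_nonneg volume Φ ℓ (hR := hℓ.le)
    rw [finrank_euclideanSpace_fin, smul_eq_mul] at h
    rw [h, hΦint]
    field_simp
  · have hzn : ‖z‖ ≠ 0 := norm_ne_zero_iff.2 hz
    have hz' : ℓ⁻¹ • z ≠ 0 := smul_ne_zero (inv_ne_zero hℓ0) hz
    have h1 := hF (ℓ⁻¹ • z) hz'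
    have hns : ‖ℓ⁻¹ • z‖ = ℓ⁻¹ * ‖z‖ := by
      rw [norm_smul, Real.norm_eq_abs, abs_inv, abs_of_pos hℓ]
    have e : ∀ p : Space, ⟪ℓ • p, ℓ⁻¹ • z⟫_ℝ = ⟪p, z⟫_ℝ := fun p => by
      rw [real_inner_smul_left, real_inner_smul_right, ← mul_assoc, mul_inv_cancel₀ hℓ0, one_mul]
    have hcos : ∫ p, Φ p * Real.cos (2 * π * ⟪p, ℓ⁻¹ • z⟫_ℝ) =
        ℓ ^ 3 * ∫ p, Φ (ℓ • p) * Real.cos (2 * π * ⟪p, z⟫_ℝ) := by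
      have h := Measure.integral_comp_smul_of_nonneg volume
        (fun p : Space => Φ p * Real.cos (2 * π * ⟪p, ℓ⁻¹ • z⟫_ℝ)) ℓ (hR := hℓ.le)
      rw [finrank_euclideanSpace_fin, smul_eq_mul] at h
      simp only [e] at h
      rw [h, ← mul_assoc, mul_inv_cancel₀ (pow_ne_zero 3 hℓ0), one_mul]
    have hint : ∫ p, ℓ ^ 2 * Φ (ℓ • p) * Real.cos (2 * π * ⟪p, z⟫_ℝ) =
        ℓ ^ 2 * ∫ p, Φ (ℓ • p) * Real.cos (2 * π * ⟪p, z⟫_ℝ) := by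
      rw [← integral_const_mul]
      refine integral_congr_ae (Eventually.of_forall fun p => ?_)
      ring
    have he : Real.exp (-(ω * ‖ℓ⁻¹ • z‖)) = Real.exp (-(ω / ℓ * ‖z‖)) := by
      rw [hns]
      congr 1
      ring
    rw [hint, smearing_comp_inv_smul χ hℓ z]
    rw [hcos, he, hns] at h1
    have key : ‖z‖⁻¹ = ℓ⁻¹ * (ℓ⁻¹ * ‖z‖)⁻¹ := by field_simp
    rw [key, h1]
    field_simp

/-! ### The sliding lemma at scale `ℓ` -/

/-- **Lieb–Solovej's sliding lemma at scale `ℓ`** [LiebSolovej2001, Lemma 3.1]: for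
`χ ∈ C_c^∞(ℝ³)` real with `∫χ² ≠ 0` there is `ω₀(χ) > 0` such that for all `ω ≥ ω₀`, all
`ℓ > 0`, distinct points `x₁, …, x_N` and every measurable integrable background `g` with finite
particle–background and background–background `Y_{ω/ℓ}`-energies, with `χ_ℓ = χ(·/ℓ)`,
`w_z(x, y) = χ_ℓ(x - z) Y_{ω/ℓ}(x - y) χ_ℓ(y - z)`, `Y_ν(x) = e^{-ν|x|}/|x|`,
`(∫χ_ℓ²)⁻¹ ∫ [∑_{i<j} w_z(xᵢ,xⱼ) - ∑ᵢ ∫ g(y) w_z(xᵢ,y) dy + ½∬ g g w_z] dz - ½ (ω/ℓ) N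
 ≤ ∑_{i<j}|xᵢ - xⱼ|⁻¹ - ∑ᵢ ∫ g(y)|xᵢ - y|⁻¹ dy + ½∬ g(x)g(y)|x - y|⁻¹`.
[cite: LiebSolovej2001, Lemma 3.1] -/
theorem sliding_lemma_jellium_scaled (hχ : ContDiff ℝ (⊤ : ℕ∞) χ) (hsupp : HasCompactSupport χ)
    (hχ0 : (∫ u, χ u ^ 2) ≠ 0) :
    ∃ ω₀ : ℝ, 0 < ω₀ ∧ ∀ ω : ℝ, ω₀ ≤ ω → ∀ ℓ : ℝ, 0 < ℓ → ∀ {N : ℕ} {X : Fin N → Space},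
      Function.Injective X → ∀ {g : Space → ℝ}, Measurable g → Integrable g →
        (∀ i, Integrable fun y : Space => g y * (Real.exp (-(ω / ℓ * ‖X i - y‖)) / ‖X i - y‖)) →
        Integrable (fun q : Space × Space => g q.1 * g q.2 *
          (Real.exp (-(ω / ℓ * ‖q.1 - q.2‖)) / ‖q.1 - q.2‖)) (volume.prod volume) →
        (∫ u, χ (ℓ⁻¹ • u) ^ 2)⁻¹ * (∫ z : Space,
            ((∑ i, ∑ j with i < j, χ (ℓ⁻¹ • (X i - z)) *
                (Real.exp (-(ω / ℓ * ‖X i - X j‖)) / ‖X i - X j‖) * χ (ℓ⁻¹ • (X j - z))) -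
              (∑ i, ∫ y, g y * (χ (ℓ⁻¹ • (X i - z)) *
                (Real.exp (-(ω / ℓ * ‖X i - y‖)) / ‖X i - y‖) * χ (ℓ⁻¹ • (y - z)))) +
              1 / 2 * ∫ q : Space × Space, g q.1 * g q.2 * (χ (ℓ⁻¹ • (q.1 - z)) *
                (Real.exp (-(ω / ℓ * ‖q.1 - q.2‖)) / ‖q.1 - q.2‖) * χ (ℓ⁻¹ • (q.2 - z)))
                  ∂(volume.prod volume))) -
          1 / 2 * (ω / ℓ) * N ≤
        (∑ i, ∑ j with i < j, ‖X i - X j‖⁻¹) - (∑ i, ∫ y, g y * ‖X i - y‖⁻¹) +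
          1 / 2 * ∫ q : Space × Space, g q.1 * g q.2 * ‖q.1 - q.2‖⁻¹ ∂(volume.prod volume) := by
  obtain ⟨ω₀, hω₀, H⟩ := cly_coulomb_decomposition_scaled hχ hsupp hχ0
  refine ⟨ω₀, hω₀, fun ω hω ℓ hℓ N X hX g hgm hg hgY hggY => ?_⟩
  obtain ⟨Φ, hΦm, hΦi, hΦ0, hΦint, hF⟩ := H ω hω ℓ hℓ
  have hχℓ : Continuous fun x : Space => χ (ℓ⁻¹ • x) :=
    hχ.continuous.comp (continuous_const_smul _)
  have hsuppℓ : HasCompactSupport fun x : Space => χ (ℓ⁻¹ • x) :=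
    hsupp.comp_smul (inv_ne_zero hℓ.ne')
  have hYm : Measurable fun x : Space => Real.exp (-(ω / ℓ * ‖x‖)) / ‖x‖ :=
    (Real.measurable_exp.comp (measurable_const.mul measurable_norm).neg).div measurable_norm
  have h := sliding_lemma_jellium hχℓ hsuppℓ hYm hΦm hΦi hΦ0 hF hX hgm hg hgY hggY
  rwa [hΦint] at h

/-! ### The uniform background of a box -/

/-- The particle–background `Y`-energy of the uniform background `ρ𝟙_Λ` is finite. [folklore] -/
theorem integrable_boxBackground_mul_yukawa {ν : ℝ} (hν : 0 < ν) (ρ L : ℝ) (x : Space) :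
    Integrable fun y : Space => (box L).indicator (fun _ => ρ) y *
      (Real.exp (-(ν * ‖x - y‖)) / ‖x - y‖) := by
  have hY : Integrable fun y : Space => Real.exp (-(ν * ‖x - y‖)) / ‖x - y‖ :=
    (integrable_yukawa_exp hν).comp_sub_left x
  refine hY.bdd_mul (c := |ρ|) ((measurable_const.indicator (measurableSet_box L)).aestronglyMeasurable)
    (Eventually.of_forall fun y => ?_)
  rw [Real.norm_eq_abs]
  by_cases hy : y ∈ box L
  · rw [indicator_of_mem hy]
  · rw [indicator_of_notMem hy, abs_zero]
    exact abs_nonneg _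

/-- The background–background `Y`-energy of the uniform background `ρ𝟙_Λ` is finite. [folklore] -/
theorem integrable_prod_boxBackground_mul_yukawa {ν : ℝ} (hν : 0 < ν) (ρ L : ℝ) :
    Integrable (fun q : Space × Space => (box L).indicator (fun _ => ρ) q.1 *
      (box L).indicator (fun _ => ρ) q.2 * (Real.exp (-(ν * ‖q.1 - q.2‖)) / ‖q.1 - q.2‖))
      (volume.prod volume) := by
  have hg := integrable_boxBackground ρ L
  have hY := integrable_yukawa_exp hν
  have h1 : Integrable (fun q : Space × Space => (box L).indicator (fun _ => ρ) q.2 *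
      (Real.exp (-(ν * ‖q.1 - q.2‖)) / ‖q.1 - q.2‖)) (volume.prod volume) := by
    have := hg.convolution_integrand (ContinuousLinearMap.mul ℝ ℝ) hY
    simpa only [ContinuousLinearMap.mul_apply'] using this
  have hm1 : Measurable fun q : Space × Space => (box L).indicator (fun _ => ρ) q.1 :=
    (measurable_boxBackground ρ L).comp measurable_fst
  have hbd : ∀ q : Space × Space, ‖(box L).indicator (fun _ => ρ) q.1‖ ≤ |ρ| := by
    intro q
    rw [Real.norm_eq_abs]
    by_cases hq : q.1 ∈ box L
    · rw [indicator_of_mem hq]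
    · rw [indicator_of_notMem hq, abs_zero]
      exact abs_nonneg _
  have h2 := h1.bdd_mul (c := |ρ|) hm1.aestronglyMeasurable (Eventually.of_forall hbd)
  refine h2.congr (Eventually.of_forall fun q => ?_)
  simp only
  ring

/-- **The sliding lemma for the jellium energy of a box** [LiebSolovej2001, Lemma 3.1]
(uniform background of density `ρ` in `Λ_L = (0, L)³`, Dirichlet or free particles): with
`χ ∈ C_c^∞`, `∫χ² ≠ 0`, `ω₀(χ)` as above, for all `ω ≥ ω₀`, `ℓ > 0`, `ρ, L ∈ ℝ` and distinct
points `x₁, …, x_N`, writing `χ_ℓ = χ(·/ℓ)`, `Y = Y_{ω/ℓ}`,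
`w_z(x, y) = χ_ℓ(x - z) Y(x - y) χ_ℓ(y - z)`, `V_Λ(x) = ∫_Λ |x - y|⁻¹dy`
(`JelliumBoseGas.backgroundPotential`) and `C = ½ρ² ∫_Λ V_Λ`
(`JelliumBoseGas.backgroundSelfEnergy`):
`(∫χ_ℓ²)⁻¹ ∫ [∑_{i<j} w_z(xᵢ,xⱼ) - ρ∑ᵢ ∫_Λ w_z(xᵢ,y)dy + ½ρ² ∬_{Λ×Λ} w_z] dz - ½(ω/ℓ)N
 ≤ ∑_{i<j} |xᵢ - xⱼ|⁻¹ - ρ ∑ᵢ V_Λ(xᵢ) + C`. [cite: LiebSolovej2001, Lemma 3.1] -/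
theorem sliding_lemma_jellium_box (hχ : ContDiff ℝ (⊤ : ℕ∞) χ) (hsupp : HasCompactSupport χ)
    (hχ0 : (∫ u, χ u ^ 2) ≠ 0) :
    ∃ ω₀ : ℝ, 0 < ω₀ ∧ ∀ ω : ℝ, ω₀ ≤ ω → ∀ ℓ : ℝ, 0 < ℓ → ∀ (ρ L : ℝ) {N : ℕ}
      {X : Fin N → Space}, Function.Injective X →
        (∫ u, χ (ℓ⁻¹ • u) ^ 2)⁻¹ * (∫ z : Space,
            ((∑ i, ∑ j with i < j, χ (ℓ⁻¹ • (X i - z)) *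
                (Real.exp (-(ω / ℓ * ‖X i - X j‖)) / ‖X i - X j‖) * χ (ℓ⁻¹ • (X j - z))) -
              ρ * (∑ i, ∫ y in box L, χ (ℓ⁻¹ • (X i - z)) *
                (Real.exp (-(ω / ℓ * ‖X i - y‖)) / ‖X i - y‖) * χ (ℓ⁻¹ • (y - z))) +
              ρ ^ 2 / 2 * ∫ q in box L ×ˢ box L, χ (ℓ⁻¹ • (q.1 - z)) *
                (Real.exp (-(ω / ℓ * ‖q.1 - q.2‖)) / ‖q.1 - q.2‖) * χ (ℓ⁻¹ • (q.2 - z))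
                  ∂(volume.prod volume))) -
          1 / 2 * (ω / ℓ) * N ≤
        (∑ i, ∑ j with i < j, ‖X i - X j‖⁻¹) - ρ * (∑ i, backgroundPotential L (X i)) +
          backgroundSelfEnergy ρ L := by
  obtain ⟨ω₀, hω₀, H⟩ := sliding_lemma_jellium_scaled hχ hsupp hχ0
  refine ⟨ω₀, hω₀, fun ω hω ℓ hℓ ρ L N X hX => ?_⟩
  have hωpos : 0 < ω := hω₀.trans_le hω
  have hν : 0 < ω / ℓ := div_pos hωpos hℓ
  have hπ : (4 : ℝ) * π ≠ 0 := by positivity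
  have h := H ω hω ℓ hℓ hX (measurable_boxBackground ρ L) (integrable_boxBackground ρ L)
    (fun i => integrable_boxBackground_mul_yukawa hν ρ L (X i))
    (integrable_prod_boxBackground_mul_yukawa hν ρ L)
  have hs : MeasurableSet (box L ×ˢ box L) := (measurableSet_box L).prod (measurableSet_box L)
  -- particle–background terms: `∫ g K = ρ ∫_Λ K`
  have hpb : ∀ K : Space → ℝ, ∫ y, (box L).indicator (fun _ => ρ) y * K y =
      ρ * ∫ y in box L, K y := by
    intro K
    have e : (fun y => (box L).indicator (fun _ => ρ) y * K y) =
        (box L).indicator fun y => ρ * K y := by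
      funext y
      by_cases hy : y ∈ box L
      · rw [indicator_of_mem hy, indicator_of_mem hy]
      · rw [indicator_of_notMem hy, indicator_of_notMem hy, zero_mul]
    rw [e, integral_indicator (measurableSet_box L), integral_const_mul]
  -- background–background terms: `∬ g g K = ρ² ∬_{Λ×Λ} K`
  have hbb : ∀ K : Space × Space → ℝ, ∫ q, (box L).indicator (fun _ => ρ) q.1 *
      (box L).indicator (fun _ => ρ) q.2 * K q ∂(volume.prod volume) =
      ρ ^ 2 * ∫ q in box L ×ˢ box L, K q ∂(volume.prod volume) := by
    intro K
    have e : (fun q : Space × Space => (box L).indicator (fun _ => ρ) q.1 *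
        (box L).indicator (fun _ => ρ) q.2 * K q) =
        (box L ×ˢ box L).indicator fun q => ρ ^ 2 * K q := by
      funext q
      by_cases h1 : q.1 ∈ box L
      · by_cases h2 : q.2 ∈ box L
        · rw [indicator_of_mem h1, indicator_of_mem h2, indicator_of_mem (mk_mem_prod h1 h2)]
          ring
        · rw [indicator_of_notMem h2,
            indicator_of_notMem (show q ∉ box L ×ˢ box L from fun h => h2 h.2)]
          ring
      · rw [indicator_of_notMem h1,
          indicator_of_notMem (show q ∉ box L ×ˢ box L from fun h => h1 h.1)]
        ring
    rw [e, integral_indicator hs, integral_const_mul]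
  -- the Coulomb background terms
  have hV : ∀ i, ∫ y, (box L).indicator (fun _ => ρ) y * ‖X i - y‖⁻¹ =
      ρ * backgroundPotential L (X i) := fun i => by
    rw [hpb, backgroundPotential]
  have hC : ∫ q, (box L).indicator (fun _ => ρ) q.1 * (box L).indicator (fun _ => ρ) q.2 *
      ‖q.1 - q.2‖⁻¹ ∂(volume.prod volume) = 2 * backgroundSelfEnergy ρ L := by
    have h2 := (integral_prod_boxBackground_coulomb ρ L).2
    have e : ∀ q : Space × Space, (box L).indicator (fun _ => ρ) q.1 *
        (box L).indicator (fun _ => ρ) q.2 * ‖q.1 - q.2‖⁻¹ =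
        4 * π * ((box L).indicator (fun _ => ρ) q.1 * (box L).indicator (fun _ => ρ) q.2 *
          (4 * π * ‖q.1 - q.2‖)⁻¹) := by
      intro q
      rw [mul_inv, show 4 * π * ((box L).indicator (fun _ => ρ) q.1 *
        (box L).indicator (fun _ => ρ) q.2 * ((4 * π)⁻¹ * ‖q.1 - q.2‖⁻¹)) =
        (4 * π * (4 * π)⁻¹) * ((box L).indicator (fun _ => ρ) q.1 *
          (box L).indicator (fun _ => ρ) q.2 * ‖q.1 - q.2‖⁻¹) by ring, mul_inv_cancel₀ hπ, one_mul]
    simp_rw [e]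
    rw [integral_const_mul, h2, ← mul_assoc, mul_inv_cancel₀ hπ, one_mul]
  -- rewrite both sides of the sliding inequality
  have hL : ∀ z : Space,
      ((∑ i, ∑ j with i < j, χ (ℓ⁻¹ • (X i - z)) *
          (Real.exp (-(ω / ℓ * ‖X i - X j‖)) / ‖X i - X j‖) * χ (ℓ⁻¹ • (X j - z))) -
        (∑ i, ∫ y, (box L).indicator (fun _ => ρ) y * (χ (ℓ⁻¹ • (X i - z)) *
          (Real.exp (-(ω / ℓ * ‖X i - y‖)) / ‖X i - y‖) * χ (ℓ⁻¹ • (y - z)))) +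
        1 / 2 * ∫ q : Space × Space, (box L).indicator (fun _ => ρ) q.1 *
          (box L).indicator (fun _ => ρ) q.2 * (χ (ℓ⁻¹ • (q.1 - z)) *
          (Real.exp (-(ω / ℓ * ‖q.1 - q.2‖)) / ‖q.1 - q.2‖) * χ (ℓ⁻¹ • (q.2 - z)))
            ∂(volume.prod volume)) =
      ((∑ i, ∑ j with i < j, χ (ℓ⁻¹ • (X i - z)) *
          (Real.exp (-(ω / ℓ * ‖X i - X j‖)) / ‖X i - X j‖) * χ (ℓ⁻¹ • (X j - z))) -
        ρ * (∑ i, ∫ y in box L, χ (ℓ⁻¹ • (X i - z)) *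
          (Real.exp (-(ω / ℓ * ‖X i - y‖)) / ‖X i - y‖) * χ (ℓ⁻¹ • (y - z))) +
        ρ ^ 2 / 2 * ∫ q in box L ×ˢ box L, χ (ℓ⁻¹ • (q.1 - z)) *
          (Real.exp (-(ω / ℓ * ‖q.1 - q.2‖)) / ‖q.1 - q.2‖) * χ (ℓ⁻¹ • (q.2 - z))
            ∂(volume.prod volume)) := by
    intro z
    rw [hbb]
    simp_rw [hpb]
    rw [← Finset.mul_sum]
    ring
  simp_rw [hL] at h
  simp_rw [hV] at h
  rw [hC, ← Finset.mul_sum] at h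
  linarith

/-! ### Integrability in the sliding variable and the split form -/

/-- The particle–particle sliding integrand `z ↦ ∑_{i<j} χ(xᵢ - z) Kᵢⱼ χ(xⱼ - z)` is integrable.
[folklore] -/
theorem integrable_sliding_pp (hχ : Continuous χ) (hsupp : HasCompactSupport χ) {N : ℕ}
    (K : Fin N → Fin N → ℝ) (X : Fin N → Space) :
    Integrable fun z : Space => ∑ i, ∑ j with i < j, χ (X i - z) * K i j * χ (X j - z) :=
  integrable_finsetSum _ fun i _ => integrable_finsetSum _ fun j _ =>
    integrable_sub_mul χ hχ hsupp (K i j) (X i) (X j)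

/-- The particle–background sliding integrand of a box,
`z ↦ ∫_Λ χ(x - z) Y_ν(x - y) χ(y - z) dy`, is integrable. [folklore] -/
theorem integrable_sliding_pb_box (hχ : Continuous χ) (hsupp : HasCompactSupport χ) {ν : ℝ}
    (hν : 0 < ν) (L : ℝ) (x : Space) :
    Integrable fun z : Space => ∫ y in box L,
      χ (x - z) * (Real.exp (-(ν * ‖x - y‖)) / ‖x - y‖) * χ (y - z) := by
  have hYm : Measurable fun x : Space => Real.exp (-(ν * ‖x‖)) / ‖x‖ :=
    (Real.measurable_exp.comp (measurable_const.mul measurable_norm).neg).div measurable_norm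
  have h := (sliding_pb_identity hχ hsupp hYm (measurable_boxBackground 1 L) x
    (integrable_boxBackground_mul_yukawa hν 1 L x)).1
  refine h.congr (Eventually.of_forall fun z => ?_)
  have e : (fun y => (box L).indicator (fun _ => (1 : ℝ)) y *
      (χ (x - z) * (Real.exp (-(ν * ‖x - y‖)) / ‖x - y‖) * χ (y - z))) =
      (box L).indicator fun y => χ (x - z) * (Real.exp (-(ν * ‖x - y‖)) / ‖x - y‖) * χ (y - z) := by
    funext y
    by_cases hy : y ∈ box L
    · rw [indicator_of_mem hy, indicator_of_mem hy, one_mul]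
    · rw [indicator_of_notMem hy, indicator_of_notMem hy, zero_mul]
  simp only
  rw [e, integral_indicator (measurableSet_box L)]

/-- The background–background sliding integrand of a box,
`z ↦ ∬_{Λ×Λ} χ(x - z) Y_ν(x - y) χ(y - z)`, is integrable. [folklore] -/
theorem integrable_sliding_bb_box (hχ : Continuous χ) (hsupp : HasCompactSupport χ) {ν : ℝ}
    (hν : 0 < ν) (L : ℝ) :
    Integrable fun z : Space => ∫ q in box L ×ˢ box L,
      χ (q.1 - z) * (Real.exp (-(ν * ‖q.1 - q.2‖)) / ‖q.1 - q.2‖) * χ (q.2 - z)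
        ∂(volume.prod volume) := by
  have hYm : Measurable fun x : Space => Real.exp (-(ν * ‖x‖)) / ‖x‖ :=
    (Real.measurable_exp.comp (measurable_const.mul measurable_norm).neg).div measurable_norm
  have hs : MeasurableSet (box L ×ˢ box L) := (measurableSet_box L).prod (measurableSet_box L)
  have h := (sliding_bb_identity hχ hsupp hYm (measurable_boxBackground 1 L)
    (integrable_prod_boxBackground_mul_yukawa hν 1 L)).1
  refine h.congr (Eventually.of_forall fun z => ?_)
  have e : (fun q : Space × Space => (box L).indicator (fun _ => (1 : ℝ)) q.1 *
      (box L).indicator (fun _ => (1 : ℝ)) q.2 *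
      (χ (q.1 - z) * (Real.exp (-(ν * ‖q.1 - q.2‖)) / ‖q.1 - q.2‖) * χ (q.2 - z))) =
      (box L ×ˢ box L).indicator fun q =>
        χ (q.1 - z) * (Real.exp (-(ν * ‖q.1 - q.2‖)) / ‖q.1 - q.2‖) * χ (q.2 - z) := by
    funext q
    by_cases h1 : q.1 ∈ box L
    · by_cases h2 : q.2 ∈ box L
      · rw [indicator_of_mem h1, indicator_of_mem h2, indicator_of_mem (mk_mem_prod h1 h2)]
        ring
      · rw [indicator_of_notMem h2,
          indicator_of_notMem (show q ∉ box L ×ˢ box L from fun h => h2 h.2)]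
        ring
    · rw [indicator_of_notMem h1,
        indicator_of_notMem (show q ∉ box L ×ˢ box L from fun h => h1 h.1)]
      ring
  simp only
  rw [e, integral_indicator hs]

/-- **The sliding lemma for the jellium energy of a box, split form** [LiebSolovej2001,
Lemma 3.1]: as `sliding_lemma_jellium_box`, with the `z`-averages of the particle–particle,
particle–background and background–background terms separated (each `z`-integrand is
integrable, `integrable_sliding_pp`, `integrable_sliding_pb_box`, `integrable_sliding_bb_box`):
`γ_ℓ∫PP_z dz - ρ γ_ℓ∫PB_z dz + ½ρ² γ_ℓ∫BB_z dz - ½(ω/ℓ)N ≤ ∑_{i<j}|xᵢ-xⱼ|⁻¹ - ρ∑ᵢV_Λ(xᵢ) + C`,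
`γ_ℓ = (∫χ_ℓ²)⁻¹`. [cite: LiebSolovej2001, Lemma 3.1] -/
theorem sliding_lemma_jellium_box_split (hχ : ContDiff ℝ (⊤ : ℕ∞) χ)
    (hsupp : HasCompactSupport χ) (hχ0 : (∫ u, χ u ^ 2) ≠ 0) :
    ∃ ω₀ : ℝ, 0 < ω₀ ∧ ∀ ω : ℝ, ω₀ ≤ ω → ∀ ℓ : ℝ, 0 < ℓ → ∀ (ρ L : ℝ) {N : ℕ}
      {X : Fin N → Space}, Function.Injective X →
        (∫ u, χ (ℓ⁻¹ • u) ^ 2)⁻¹ * (∫ z : Space, ∑ i, ∑ j with i < j, χ (ℓ⁻¹ • (X i - z)) *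
            (Real.exp (-(ω / ℓ * ‖X i - X j‖)) / ‖X i - X j‖) * χ (ℓ⁻¹ • (X j - z))) -
          ρ * ((∫ u, χ (ℓ⁻¹ • u) ^ 2)⁻¹ * ∫ z : Space, ∑ i, ∫ y in box L,
            χ (ℓ⁻¹ • (X i - z)) * (Real.exp (-(ω / ℓ * ‖X i - y‖)) / ‖X i - y‖) *
              χ (ℓ⁻¹ • (y - z))) +
          ρ ^ 2 / 2 * ((∫ u, χ (ℓ⁻¹ • u) ^ 2)⁻¹ * ∫ z : Space, ∫ q in box L ×ˢ box L,
            χ (ℓ⁻¹ • (q.1 - z)) * (Real.exp (-(ω / ℓ * ‖q.1 - q.2‖)) / ‖q.1 - q.2‖) *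
              χ (ℓ⁻¹ • (q.2 - z)) ∂(volume.prod volume)) -
          1 / 2 * (ω / ℓ) * N ≤
        (∑ i, ∑ j with i < j, ‖X i - X j‖⁻¹) - ρ * (∑ i, backgroundPotential L (X i)) +
          backgroundSelfEnergy ρ L := by
  obtain ⟨ω₀, hω₀, H⟩ := sliding_lemma_jellium_box hχ hsupp hχ0
  refine ⟨ω₀, hω₀, fun ω hω ℓ hℓ ρ L N X hX => ?_⟩
  have h := H ω hω ℓ hℓ ρ L hX
  have hν : 0 < ω / ℓ := div_pos (hω₀.trans_le hω) hℓ
  have hχℓ : Continuous fun x : Space => χ (ℓ⁻¹ • x) :=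
    hχ.continuous.comp (continuous_const_smul _)
  have hsuppℓ : HasCompactSupport fun x : Space => χ (ℓ⁻¹ • x) :=
    hsupp.comp_smul (inv_ne_zero hℓ.ne')
  have hPP : Integrable fun z : Space => ∑ i, ∑ j with i < j, χ (ℓ⁻¹ • (X i - z)) *
      (Real.exp (-(ω / ℓ * ‖X i - X j‖)) / ‖X i - X j‖) * χ (ℓ⁻¹ • (X j - z)) :=
    integrable_sliding_pp hχℓ hsuppℓ
      (fun i j => Real.exp (-(ω / ℓ * ‖X i - X j‖)) / ‖X i - X j‖) X
  have hPB : Integrable fun z : Space => ∑ i, ∫ y in box L,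
      χ (ℓ⁻¹ • (X i - z)) * (Real.exp (-(ω / ℓ * ‖X i - y‖)) / ‖X i - y‖) *
        χ (ℓ⁻¹ • (y - z)) :=
    integrable_finsetSum _ fun i _ => integrable_sliding_pb_box hχℓ hsuppℓ hν L (X i)
  have hBB : Integrable fun z : Space => ∫ q in box L ×ˢ box L,
      χ (ℓ⁻¹ • (q.1 - z)) * (Real.exp (-(ω / ℓ * ‖q.1 - q.2‖)) / ‖q.1 - q.2‖) *
        χ (ℓ⁻¹ • (q.2 - z)) ∂(volume.prod volume) :=
    integrable_sliding_bb_box hχℓ hsuppℓ hν L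
  have hI1 : Integrable fun z : Space => (∑ i, ∑ j with i < j, χ (ℓ⁻¹ • (X i - z)) *
      (Real.exp (-(ω / ℓ * ‖X i - X j‖)) / ‖X i - X j‖) * χ (ℓ⁻¹ • (X j - z))) -
      ρ * (∑ i, ∫ y in box L, χ (ℓ⁻¹ • (X i - z)) *
        (Real.exp (-(ω / ℓ * ‖X i - y‖)) / ‖X i - y‖) * χ (ℓ⁻¹ • (y - z))) :=
    hPP.sub (hPB.const_mul ρ)
  have hI2 : Integrable fun z : Space => ρ ^ 2 / 2 * ∫ q in box L ×ˢ box L,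
      χ (ℓ⁻¹ • (q.1 - z)) * (Real.exp (-(ω / ℓ * ‖q.1 - q.2‖)) / ‖q.1 - q.2‖) *
        χ (ℓ⁻¹ • (q.2 - z)) ∂(volume.prod volume) :=
    hBB.const_mul _
  have hI3 : Integrable fun z : Space => ρ * (∑ i, ∫ y in box L, χ (ℓ⁻¹ • (X i - z)) *
      (Real.exp (-(ω / ℓ * ‖X i - y‖)) / ‖X i - y‖) * χ (ℓ⁻¹ • (y - z))) :=
    hPB.const_mul ρ
  rw [integral_add hI1 hI2, integral_sub hPP hI3, integral_const_mul, integral_const_mul] at h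
  linarith

end Literature.MathematicalPhysics.QuantumManyBody.Coulomb
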